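import Summits.QuantumAdvantage.AdviceFreeQNC0.AffBells28Peeling
import HarnessLib

/-!
# `AffBells28.PeelingList` PROVED — peeling along a list of disjoint pair moves (planner qn-p1 g28, ROUND-27 §28.2; ask P-28a (ii))

Prover seat qn-prover-3 g14.  **`peelingList : PeelingList`**: if the XOR of the ACTIVE tests is constant on `SubFibre x C₀` and `x₁` is a
point of it, then for every list `L` of pairwise disjoint coin pairs of `C₀` the XOR of the tests of the SURVIVORS `surv β x x₁ L`
(active rows seeing every move), with the peeled offsets `cShift β c x₁ L`, is constant on `SubFibre x₁ (C₀ ∖ moveCoins L)`.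
Induction on `L` over the one-step `peeling` (`AffBells28Peeling.lean`): the base case is `SubFibre x₁ C₀ ⊆ SubFibre x C₀`
(`subFibre_subset_of_mem`); the step peels the head pair off the induction hypothesis for the tail (the order of the moves is immaterial:
`surv` is a conjunction and `cShift` a sum).
WHAT THIS IS NOT: `Leaf` is NOT proved here (so `IsoRefutes` is still open); separation NOT moved.
-/

namespace Summit.QuantumAdvantage.AdviceFreeQNC0

namespace AffBells28

open Finset Literature.Computability.QuantumComplexity Literature.Computability.QuantumComplexity.RingHLF
open AffBells23 AffBells26 Fib19

variable {N : ℕ}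

/-- Sub-fibres are nested along their points. -/
theorem subFibre_subset_of_mem {x x₁ : Fin N → Bool} {C : Finset (Fin N)} (h : x₁ ∈ SubFibre x C) :
    SubFibre x₁ C ⊆ SubFibre x C := by
  intro y hy
  rw [mem_subFibre] at h hy ⊢
  exact ⟨hy.1, hy.2.1.trans h.2.1, fun i hi => (hy.2.2 i hi).trans (h.2.2 i hi)⟩

/-- A point lies in its own sub-fibre. -/
theorem mem_subFibre_self {x x₁ : Fin N → Bool} {C C' : Finset (Fin N)} (h : x₁ ∈ SubFibre x C) : x₁ ∈ SubFibre x₁ C' := by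
  rw [mem_subFibre] at h ⊢
  exact ⟨h.1, rfl, fun _ _ => rfl⟩

/-! ### The list bookkeeping -/

/-- No moves: every active row survives. -/
theorem surv_nil (β : Fin N → Fin N → ZMod 3) (x x₁ : Fin N → Bool) : surv β x x₁ [] = act x := by
  unfold surv
  exact filter_true_of_mem fun g _ p hp => absurd hp List.not_mem_nil

/-- No moves: the offsets are unchanged. -/
theorem cShift_nil (β : Fin N → Fin N → ZMod 3) (c : Fin N → ZMod 3) (x₁ : Fin N → Bool) : cShift β c x₁ [] = c := by
  funext g
  unfold cShift
  simp

/-- No moves use no coins. -/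
theorem moveCoins_nil : moveCoins ([] : List (Fin N × Fin N)) = ∅ := by
  unfold moveCoins
  simp

/-- One more move: the survivors are the previous survivors seeing it. -/
theorem surv_cons (β : Fin N → Fin N → ZMod 3) (x x₁ : Fin N → Bool) (p : Fin N × Fin N) (L : List (Fin N × Fin N)) :
    surv β x x₁ (p :: L) = (surv β x x₁ L).filter fun g => dPair β x₁ g p.1 p.2 ≠ 0 := by
  unfold surv
  rw [filter_filter]
  refine filter_congr fun g _ => ?_
  simp only [List.forall_mem_cons]
  exact and_comm

/-- One more move: the offsets shift by its `dPair`. -/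
theorem cShift_cons (β : Fin N → Fin N → ZMod 3) (c : Fin N → ZMod 3) (x₁ : Fin N → Bool) (p : Fin N × Fin N)
    (L : List (Fin N × Fin N)) :
    cShift β c x₁ (p :: L) = fun g => cShift β c x₁ L g + dPair β x₁ g p.1 p.2 := by
  funext g
  unfold cShift
  simp only [List.map_cons, List.sum_cons]
  ring

/-- One more move: the free coins lose its two coins. -/
theorem sdiff_moveCoins_cons (C₀ : Finset (Fin N)) (p : Fin N × Fin N) (L : List (Fin N × Fin N)) :
    C₀ \ moveCoins (p :: L) = ((C₀ \ moveCoins L).erase p.1).erase p.2 := by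
  ext k
  unfold moveCoins
  simp only [mem_sdiff, mem_erase, List.mem_toFinset, List.mem_append, List.mem_map, List.mem_cons]
  constructor
  · rintro ⟨hk, hnot⟩
    refine ⟨fun h => hnot (Or.inr ⟨p, Or.inl rfl, h.symm⟩), fun h => hnot (Or.inl ⟨p, Or.inl rfl, h.symm⟩), hk, ?_⟩
    rintro (⟨q, hq, hqk⟩ | ⟨q, hq, hqk⟩)
    · exact hnot (Or.inl ⟨q, Or.inr hq, hqk⟩)
    · exact hnot (Or.inr ⟨q, Or.inr hq, hqk⟩)
  · rintro ⟨hk2, hk1, hk, hnot⟩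
    refine ⟨hk, ?_⟩
    rintro (⟨q, hq, hqk⟩ | ⟨q, hq, hqk⟩)
    · rcases hq with rfl | hq
      · exact hk1 hqk.symm
      · exact hnot (Or.inl ⟨q, hq, hqk⟩)
    · rcases hq with rfl | hq
      · exact hk2 hqk.symm
      · exact hnot (Or.inr ⟨q, hq, hqk⟩)

/-- Unpacking `MovesIn` for a cons. -/
theorem movesIn_cons {C₀ : Finset (Fin N)} {p : Fin N × Fin N} {L : List (Fin N × Fin N)} (h : MovesIn C₀ (p :: L)) :
    MovesIn C₀ L ∧ p.1 ∈ C₀ \ moveCoins L ∧ p.2 ∈ C₀ \ moveCoins L ∧ p.1 ≠ p.2 := by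
  obtain ⟨hmem, hnd⟩ := h
  simp only [List.map_cons, List.cons_append] at hnd
  rw [List.nodup_cons] at hnd
  obtain ⟨h1, hnd'⟩ := hnd
  rw [List.nodup_middle, List.nodup_cons] at hnd'
  obtain ⟨h2, hnd''⟩ := hnd'
  simp only [List.mem_append, List.mem_cons, not_or] at h1 h2
  refine ⟨⟨fun q hq => hmem q (List.mem_cons_of_mem _ hq), hnd''⟩, ?_, ?_, h1.2.1⟩
  · rw [mem_sdiff]
    refine ⟨(hmem p List.mem_cons_self).1, fun h => ?_⟩
    unfold moveCoins at h
    rw [List.mem_toFinset, List.mem_append] at h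
    rcases h with h | h
    · exact h1.1 h
    · exact h1.2.2 h
  · rw [mem_sdiff]
    refine ⟨(hmem p List.mem_cons_self).2, fun h => ?_⟩
    unfold moveCoins at h
    rw [List.mem_toFinset, List.mem_append] at h
    rcases h with h | h
    · exact h2.1 h
    · exact h2.2 h

/-! ### The induction -/

/-- **`PeelingList` holds.** -/
theorem peelingList : PeelingList := by
  intro N hN β c x C₀ hodd hC₀ hS x₁ hx₁ L
  induction L with
  | nil =>
    intro _
    rw [surv_nil, cShift_nil, moveCoins_nil, sdiff_empty]
    intro y hy y' hy'
    exact hS y (subFibre_subset_of_mem hx₁ hy) y' (subFibre_subset_of_mem hx₁ hy')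
  | cons p L ih =>
    intro hM
    obtain ⟨hML, hp1, hp2, hne⟩ := movesIn_cons hM
    have h := ih hML
    have hodd₁ : IsOdd x₁ := ((mem_subFibre).1 hx₁).1
    have hk₁ : kline x₁ = kline x := ((mem_subFibre).1 hx₁).2.1
    have hsub : C₀ \ moveCoins L ⊆ klineZeros x₁ := by
      intro k hk
      have := hC₀ (mem_sdiff.1 hk).1
      unfold klineZeros at this ⊢
      rw [mem_filter] at this ⊢
      exact ⟨this.1, by rw [hk₁]; exact this.2⟩
    have hstep := peeling N hN β (cShift β c x₁ L) (surv β x x₁ L) x₁ (C₀ \ moveCoins L) hodd₁ hsub h x₁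
      (mem_subFibre_self hx₁) p.1 hp1 p.2 hp2 hne
    rw [surv_cons, cShift_cons, sdiff_moveCoins_cons]
    exact hstep

end AffBells28

end Summit.QuantumAdvantage.AdviceFreeQNC0
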